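import Mathlib
import Literature.AlgebraicGeometry.Resolution.AbhyankarEtaleAscent
import HarnessLib

/-!
# The standard-étale model of Knaf–Kuhlmann's Lemma 5.1 with its `B`-algebra structure exported (formally unramified, finitely presented over `B`)

Route `RadicialJung`, crux `CleanModels` (stmt-ResolutionOfSingularities-15917), line `Sketch` rev 35; explicit-unit seat `decomp-res-hand-1` g3.
GROUNDWORK (step 4 of the recipe in `Cruxes/CleanModels/Lines/Sketch-memo-hand1-g3.md` §7) for the discharge of the printed input
`Literature.AlgebraicGeometry.Resolution.KnafKuhlmann2005_Thm11_monomialForm` (Knaf–Kuhlmann 2005, Thm. 1.1 WITH its monomial clause).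
The tree's PROVED `exists_standardEtale_model` (`AbhyankarEtaleAscent.lean:211`, the heart of KK05 Lemma 5.1: `C := B[η]_{g(η)} ≅ (B[X]/(f))_g`
standard étale over `B`, hence finitely presented and smooth over `K`) returns the model `C` only as a `K`-subalgebra with its `K`-smoothness.  For
the «Moreover» clause one needs `C` AS A `B`-ALGEBRA: it is formally unramified (indeed standard étale) and finitely presented over `B`, so that
the maximal ideal of the toric local ring `B_𝔭 = K[x',y]_{(x')}` extends to the maximal ideal of `C_q` (✓ `KK05ValueBasis.maximalIdeal_eq_span_of_formallyUnramified`,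
p794493) and the Perron variables `x'` stay a regular system of parameters.  This file re-runs the tree's proof verbatim and exports the extra
structure, plus the normal form `w = q(η)/g(η)ⁿ` of the elements of `C`:

* `exists_standardEtale_model_unramified` — as `exists_standardEtale_model`, with `A : Subalgebra B Ω`, `Algebra.FinitePresentation B A`,
  `Algebra.FormallyUnramified B A`, the `K`-facts for `A.restrictScalars K`, and `∀ w ∈ A, ∃ q n, w = q(η)/g(η)ⁿ`.

OURS (re-export of a landed construction; the mathematics is Knaf–Kuhlmann's Lemma 5.1 / [Ray] V Thm. 1); proves nothing about resolution of
singularities in characteristic `p`. counted 0.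
-/

noncomputable section

set_option linter.dupNamespace false -- mandated namespace of this single-conjunct summit

open IsLocalRing Polynomial
open Literature.AlgebraicGeometry.Resolution

namespace Summit.ResolutionOfSingularities.ResolutionOfSingularities.Theorems.RadicialJung.CleanModels

namespace KK05ValueBasis

universe u

variable {Ω : Type u} [Field Ω]

set_option maxHeartbeats 800000 in -- the tower `K → B → (B[X]/(f))_g` instance searches are deep (as in the tree's original)
/-- **The standard-étale model with its `B`-algebra structure** (Knaf–Kuhlmann 2005, Lemma 5.1, case `R = K`; [Ray] V Thm. 1): under the
hypotheses of `exists_standardEtale_model` — `B ⊆ 𝒪_V ∩ F` smooth over `K` and normal, `η ∈ 𝒪_V ∩ F` with monic minimal equation `f` over `B`,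
`f'h + f p₂ = gˢ`, `v(g(η)) = 1` — the model `C := B[η]_{g(η)} ⊆ 𝒪_V ∩ F` is returned as a `B`-SUBALGEBRA, finitely presented and FORMALLY
UNRAMIFIED over `B` (it is `B`-isomorphic to the standard-étale `(B[X]/(f))_g`), finitely presented and smooth over `K` at its centre, containing
every `q(η)`, `q ∈ B[X]`, and with every element of the form `q(η)/g(η)ⁿ`. [cite: KnafKuhlmann2005, Lemma 5.1 (proof, pp. 12–13)] -/
theorem exists_standardEtale_model_unramified (V : ValuationSubring Ω) {K : Subfield Ω} (B : Subalgebra K Ω) [Algebra.Smooth K B]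
    [IsIntegrallyClosed B] (hBV : B.toSubring ≤ V.toSubring) {F : Subfield Ω}
    (hBF : (B : Set Ω) ⊆ F) {η : Ω} (hηV : η ∈ V) (hηF : η ∈ F)
    (fB gB hB p₂B : Polynomial B) (s : ℕ) (hfBmon : fB.Monic) (hfBη : Polynomial.aeval η fB = 0)
    (hfBmin : ∀ q : Polynomial B, q ≠ 0 → Polynomial.aeval η q = 0 → fB.natDegree ≤ q.natDegree)
    (hidentB : Polynomial.derivative fB * hB + fB * p₂B = gB ^ s)
    (hvg : V.valuation (Polynomial.aeval η gB) = 1) :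
    ∃ (A : Subalgebra B Ω) (hAV : A.toSubring ≤ V.toSubring), (A : Set Ω) ⊆ F ∧
      Algebra.FinitePresentation K A ∧ @Algebra.IsSmoothAt K A _ _ _ (centre A V hAV) _ ∧
      Algebra.FinitePresentation B A ∧ Algebra.FormallyUnramified B A ∧
      (∀ q : Polynomial B, Polynomial.aeval η q ∈ A) ∧
      ∀ w ∈ A, ∃ (q : Polynomial B) (n : ℕ), w = Polynomial.aeval η q / Polynomial.aeval η gB ^ n := by
  classical
  have hgη0 : Polynomial.aeval η gB ≠ 0 := fun h0 => by
    rw [h0, map_zero] at hvg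
    exact zero_ne_one hvg
  have hinj : Function.Injective (algebraMap B Ω) := Subtype.val_injective
  -- `fB` is the minimal polynomial of `η` over `B`
  have hint : IsIntegral B η := ⟨fB, hfBmon, by rw [← Polynomial.aeval_def]; exact hfBη⟩
  have hmin : fB = minpoly B η := by
    refine minpoly.unique' B η hfBmon hfBη fun q hq => ?_
    by_cases hq0 : q = 0
    · exact Or.inl hq0
    · refine Or.inr fun hq' => ?_
      exact absurd (Polynomial.natDegree_lt_natDegree hq0 hq) (not_lt.mpr (hfBmin q hq0 hq'))
  -- `φ₀ : B[X]/(f) → Ω`, `X ↦ η`, is injective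
  let φ₀ : AdjoinRoot fB →ₐ[B] Ω := AdjoinRoot.liftAlgHom fB (Algebra.ofId B Ω) η
    (by rw [Algebra.toRingHom_ofId, ← Polynomial.aeval_def]; exact hfBη)
  have hφ₀mk : ∀ q : Polynomial B, φ₀ (AdjoinRoot.mk fB q) = Polynomial.aeval η q := fun q => by
    simp only [φ₀, AdjoinRoot.liftAlgHom_mk, Polynomial.aeval_def, Algebra.toRingHom_ofId]
  have hφ₀ : Function.Injective φ₀ := by
    rw [injective_iff_map_eq_zero]
    intro p hp
    obtain ⟨q, rfl⟩ := AdjoinRoot.mk_surjective p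
    rw [hφ₀mk] at hp
    rw [AdjoinRoot.mk_eq_zero, hmin]
    exact minpoly.isIntegrallyClosed_dvd hint hp
  -- the standard-étale algebra `L = (B[X]/(f))[1/g]` and `ψ : L → Ω`
  set r : AdjoinRoot fB := AdjoinRoot.mk fB gB with hr
  have hφ₀r : φ₀ r = Polynomial.aeval η gB := by rw [hr, hφ₀mk]
  have hrunit : IsUnit (φ₀ r) := by rw [hφ₀r]; exact isUnit_iff_ne_zero.mpr hgη0
  let L := Localization.Away r
  let ψ : L →ₐ[B] Ω := IsLocalization.Away.liftAlgHom r (f := φ₀) hrunit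
  have hψalg : ∀ a : AdjoinRoot fB, ψ (algebraMap (AdjoinRoot fB) L a) = φ₀ a := fun a => by
    simp only [ψ, IsLocalization.Away.coe_liftAlgHom, IsLocalization.Away.lift_eq]
    rfl
  have hnf : ∀ l : L, ∃ (q : Polynomial B) (n : ℕ),
      ψ l = Polynomial.aeval η q / Polynomial.aeval η gB ^ n := by
    intro l
    obtain ⟨⟨a, m⟩, hlm⟩ := IsLocalization.surj (Submonoid.powers r) l
    obtain ⟨n, hn⟩ := (Submonoid.mem_powers_iff _ _).mp m.2
    obtain ⟨q, rfl⟩ := AdjoinRoot.mk_surjective a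
    refine ⟨q, n, ?_⟩
    have h1 : ψ l * Polynomial.aeval η gB ^ n = Polynomial.aeval η q := by
      have := congrArg ψ hlm
      rw [map_mul, hψalg, hψalg, hφ₀mk] at this
      rw [← this, ← hn, map_pow, hφ₀r]
    rw [← h1, mul_div_assoc, div_self (pow_ne_zero n hgη0), mul_one]
  have hψ : Function.Injective ψ := by
    rw [injective_iff_map_eq_zero]
    intro l hl
    obtain ⟨⟨a, m⟩, hlm⟩ := IsLocalization.surj (Submonoid.powers r) l
    have h1 : φ₀ a = 0 := by
      have := congrArg ψ hlm
      rw [map_mul, hψalg, hψalg, hl, zero_mul] at this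
      exact this.symm
    have ha : a = 0 := hφ₀ (by rw [h1, map_zero])
    rw [ha, map_zero] at hlm
    exact (IsLocalization.map_units L m).mul_left_eq_zero.mp hlm
  -- `L` is standard étale over `B`, hence smooth over `K`; so is its image `A = ψ(L) ⊆ Ω`
  let SE : StandardEtalePair B :=
    { f := fB, monic_f := hfBmon, g := gB, cond := ⟨hB, p₂B, s, hidentB⟩ }
  haveI : Algebra.IsStandardEtale B L := Algebra.IsStandardEtale.of_equiv SE.equivAwayAdjoinRoot
  haveI : Algebra.Etale B L := inferInstance
  haveI hfsL : Algebra.FormallySmooth K L := Algebra.FormallySmooth.comp K B L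
  haveI hfpL : Algebra.FinitePresentation K L := Algebra.FinitePresentation.trans K B L
  haveI hfuL : Algebra.FormallyUnramified B L := inferInstance
  haveI hfpBL : Algebra.FinitePresentation B L := inferInstance
  set A : Subalgebra B Ω := ψ.range with hA
  let eA : L ≃ₐ[B] A := AlgEquiv.ofInjective ψ hψ
  have hfpA : Algebra.FinitePresentation B A := Algebra.FinitePresentation.equiv (R := B) (A := L) (B := A) eA
  have hfuA : Algebra.FormallyUnramified B A := Algebra.FormallyUnramified.of_equiv (R := B) (A := L) (B := A) eA
  -- the `K`-structure of `A` (tower `K → B → A`)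
  haveI : Algebra.FinitePresentation B A := hfpA
  haveI : Algebra.FormallySmooth B A := Algebra.FormallySmooth.of_equiv eA
  have hfpAK : Algebra.FinitePresentation K A := Algebra.FinitePresentation.trans K B A
  haveI hfsAK : Algebra.FormallySmooth K A := Algebra.FormallySmooth.comp K B A
  -- membership facts for `A`
  have hmemA : ∀ w : Ω, w ∈ A ↔ ∃ l, ψ l = w := fun w => AlgHom.mem_range ψ
  have hpolyA : ∀ q : Polynomial B, Polynomial.aeval η q ∈ A := fun q =>
    (hmemA _).mpr ⟨algebraMap _ L (AdjoinRoot.mk fB q), by rw [hψalg, hφ₀mk]⟩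
  have hnumV : ∀ q : Polynomial B, Polynomial.aeval η q ∈ V := fun q => by
    rw [aeval_eq_eval_map]
    exact eval_mem_of_coeff_mem V _
      (fun k => by rw [Polynomial.coeff_map]; exact hBV (q.coeff k).2) hηV
  have hnumF : ∀ q : Polynomial B, Polynomial.aeval η q ∈ F := fun q => by
    rw [aeval_eq_eval_map]
    exact eval_mem_of_coeff_mem F _
      (fun k => by rw [Polynomial.coeff_map]; exact hBF (q.coeff k).2) hηF
  have hgpowV : ∀ n : ℕ, (Polynomial.aeval η gB ^ n)⁻¹ ∈ V := fun n =>
    (V.valuation_le_one_iff _).mp (by rw [map_inv₀, map_pow, hvg, one_pow, inv_one])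
  have hAV : A.toSubring ≤ V.toSubring := by
    intro w hw
    obtain ⟨l, rfl⟩ := (hmemA w).mp hw
    obtain ⟨q, n, hq⟩ := hnf l
    rw [hq, div_eq_mul_inv]
    exact mul_mem (hnumV q) (hgpowV n)
  have hAF : (A : Set Ω) ⊆ F := by
    intro w hw
    obtain ⟨l, rfl⟩ := (hmemA w).mp hw
    obtain ⟨q, n, hq⟩ := hnf l
    rw [hq]
    exact div_mem (hnumF q) (pow_mem (hnumF gB) n)
  refine ⟨A, hAV, hAF, hfpAK, isSmoothAt_of_formallySmooth _, hfpA, hfuA, hpolyA, fun w hw => ?_⟩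
  obtain ⟨l, rfl⟩ := (hmemA w).mp hw
  obtain ⟨q, n, hq⟩ := hnf l
  exact ⟨q, n, hq⟩

end KK05ValueBasis

end Summit.ResolutionOfSingularities.ResolutionOfSingularities.Theorems.RadicialJung.CleanModels

end

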